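import Summits.QuantumFields.YangMills.Theorems.TwistedTraceScaling.Negative.CoreWindowBand
import HarnessLib

/-!
# R54C (crux `TwistedTraceScaling`, stmt-QuantumFields-20203): the CORE TRANSFER OF RECORD (`…BOCoreTransferRecord.core_transfer_record`, lane A, 2026-08-29T08:00Z)
# cannot feed `BOBricks.hb_small` — its defect constant is rate-free AND sits at the action ceiling `q = 1/3`

Standing disprover `ym-cdisprove-20203-1` (gen 43), sequel of R53S/R54/R54B.  `core_transfer_record` pins the colour-averaged fibre transfer at slow-window points
(`δ = δu = σ = powScale (1/3) β`) to `c₁(β)·M(v')·K̃₁/K₁` within the factors `e^{∓E(β)}(1 ∓ η)`, where `E(β)` is the slow-window transport exponent of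
`…BOCentralRatesSix.tendsto_coreExp_schedule_delta` (`→ 0`, true) and `η > 0` is a CONSTANT (the statement is `∀ η > 0, ∀ᶠ β, …`).  The relative defect it certifies is therefore
`ε(β) = max (1 − e^{−E(β)}(1 − η)) (e^{E(β)}(1 + η) − 1)` — R53S's defect constant at `(E, η)`.  Two independent reasons why no `b ≥ c·ε` meets `hb_small`
(`∀ a > 0, ∀ᶠ β, b² ≤ a·λ_b(L³β)`):
* `constant_defect_not_hb_small`: for ANY exponent `E ≥ 0` and a CONSTANT colour defect `η > 0`, `ε ≥ η` — a positive constant — while `λ_b(L³β) → 0`: RATE-FREE (C1) input never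
  reaches `hb_small`, whatever the windows;
* `coreTransferRecord_defect_not_hb_small`: even with a colour defect `η_c(β) → 0` at any rate, the record's exponent `E` (action ceiling `powScale (1/3) β`) alone sinks it (R53S).
Repair (theirs, stated): a quasimode WITH RATE `η_c(β)² ≤ aλ_b` and windows in the box (`σ = powScale q β`, `q > 1/3`; `δu = 13(L³β)^{-1/5}`) — then `R54B.defectConst_hb_small`.
HONEST FRAMING: stub of a child of the CONDITIONAL reduction route R2b1; `core_transfer_record` is TRUE as stated and nothing here refutes it or `TwistedTraceScaling`; (C4), (C5),
(B-ST), C4-CORE remain OPEN; not infinite volume, not a mass gap, not Clay.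
-/

set_option autoImplicit false

noncomputable section

open Real Filter Topology
open Literature.MathematicalPhysics.QuantumFieldTheory
open Literature.MathematicalPhysics.QuantumLattice
open Summit.QuantumFields.YangMills.Theorems.FemtoTransferGap
open Summit.QuantumFields.YangMills.Theorems.FemtoTransferGap.TwoLattice
open Summit.QuantumFields.YangMills.Theorems.FemtoTransferGap.TwoLattice.ConstTube (coreEta coreEps1 coreEps2 btLog tendsto_powScale')
open Summit.QuantumFields.YangMills.Theorems.TwistedTraceScaling.Negative

namespace Summit.QuantumFields.YangMills.Theorems.TwistedTraceScaling.Negative.R54C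

variable {L : ℕ} [NeZero L]

/-- `λ_b(L³β) → 0` along `β → ∞`. [folklore] -/
theorem tendsto_bareLambda_cube : Tendsto (fun β : ℝ => bareLambda ((L : ℝ) ^ 3 * β)) atTop (𝓝 0) := by
  have h : Tendsto (fun β : ℝ => (2 / (L : ℝ) ^ 3) ^ ((1 : ℝ) / 3) * powScale (1 / 3) β) atTop (𝓝 0) := by
    simpa using (tendsto_powScale' (show (0 : ℝ) < 1 / 3 by norm_num)).const_mul ((2 / (L : ℝ) ^ 3) ^ ((1 : ℝ) / 3))
  refine h.congr' ?_
  filter_upwards [eventually_ge_atTop (1 : ℝ)] with β hβ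
  exact (R53.bareLambda_cube_eq_powScale (L := L) hβ).symm

/-- ★★ **A RATE-FREE COLOUR DEFECT NEVER REACHES `hb_small`.**  For any exponent `E(β) ≥ 0` (eventually) and a CONSTANT `η > 0`, the defect constant
`ε = max (1 − e^{−E}(1 − η)) (e^{E}(1 + η) − 1)` is `≥ η`; hence no `b ≥ c·ε` (`c > 0`) satisfies `∀ a > 0, ∀ᶠ β, b² ≤ a·λ_b(L³β)`.  This is the shape in which
`…BOCoreTransferRecord.core_transfer_record` (`∀ η > 0, ∀ᶠ β`, factors `e^{∓E}(1 ∓ η)`) delivers (C1) to (C4). [folklore] -/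
theorem constant_defect_not_hb_small {E b : ℝ → ℝ} {η c : ℝ} (hη : 0 < η) (hc : 0 < c) (hE : ∀ᶠ β : ℝ in atTop, 0 ≤ E β)
    (hfloor : ∀ᶠ β : ℝ in atTop, c * max (1 - Real.exp (-E β) * (1 - η)) (Real.exp (E β) * (1 + η) - 1) ≤ b β) :
    ¬ ∀ a : ℝ, 0 < a → ∀ᶠ β : ℝ in atTop, b β ^ 2 ≤ a * bareLambda ((L : ℝ) ^ 3 * β) := by
  intro H
  have hpos : 0 < (c * η) ^ 2 := by positivity
  have hsmall : ∀ᶠ β : ℝ in atTop, bareLambda ((L : ℝ) ^ 3 * β) < (c * η) ^ 2 :=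
    (tendsto_bareLambda_cube (L := L)).eventually (eventually_lt_nhds hpos)
  obtain ⟨β, hb, hEβ, hfl, hsm⟩ := ((H 1 one_pos).and (hE.and (hfloor.and hsmall))).exists
  have hε : η ≤ max (1 - Real.exp (-E β) * (1 - η)) (Real.exp (E β) * (1 + η) - 1) := R53S.etac_le_defectConst hEβ hη.le
  have hcb : c * η ≤ b β := le_trans (mul_le_mul_of_nonneg_left hε hc.le) hfl
  have hcη : 0 ≤ c * η := by positivity
  nlinarith [mul_self_le_mul_self hcη hcb]

/-- ★★ **THE CORE TRANSFER OF RECORD's DEFECT CONSTANT FAILS `hb_small` EVEN WITH A VANISHING COLOUR DEFECT**: with the record's windows `δ = δu = σ = powScale (1/3) β` on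
schedule B (`T_B`, `r_f`, `Γ_B` — verbatim the exponent of `core_transfer_record` / `…BOCentralRatesSix`), for every `η_c(β) ≥ 0` eventually and every `c > 0`, no `b ≥ c·ε`
satisfies `hb_small` (R53S `not_hb_small_of_coreDefect_third`: the action ceiling `q = 1/3` alone sinks it). [cite: Luscher1983, §3] -/
theorem coreTransferRecord_defect_not_hb_small {ηc b : ℝ → ℝ} {c : ℝ} (hc : 0 < c) (hηc : ∀ᶠ β : ℝ in atTop, 0 ≤ ηc β)
    (hfloor : ∀ᶠ β : ℝ in atTop,
      c * max (1 - Real.exp (-(coreEta L β (powScale (1 / 3) β) ((powScale (1 / 3) β) + (powScale (1 / 3) β)) (9 * (L : ℝ) * (5 * (powScale (1 / 2) β * btLog β ^ 2)) + (powScale 1 β))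
              (min (1 / 40) (powScale (1 / 2) β * btLog β)) (powScale 1 β * Fintype.card (Site 3 L)) (powScale (1 / 3) β) +
            coreEps1 L β (powScale (1 / 3) β) (9 * (L : ℝ) * (5 * (powScale (1 / 2) β * btLog β ^ 2)) + (powScale 1 β)) (min (1 / 40) (powScale (1 / 2) β * btLog β)) +
            coreEps2 L β (powScale (1 / 3) β) (9 * (L : ℝ) * (5 * (powScale (1 / 2) β * btLog β ^ 2)) + (powScale 1 β)) (min (1 / 40) (powScale (1 / 2) β * btLog β))
              (powScale (1 / 3) β))) * (1 - ηc β))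
          (Real.exp (coreEta L β (powScale (1 / 3) β) ((powScale (1 / 3) β) + (powScale (1 / 3) β)) (9 * (L : ℝ) * (5 * (powScale (1 / 2) β * btLog β ^ 2)) + (powScale 1 β))
              (min (1 / 40) (powScale (1 / 2) β * btLog β)) (powScale 1 β * Fintype.card (Site 3 L)) (powScale (1 / 3) β) +
            coreEps1 L β (powScale (1 / 3) β) (9 * (L : ℝ) * (5 * (powScale (1 / 2) β * btLog β ^ 2)) + (powScale 1 β)) (min (1 / 40) (powScale (1 / 2) β * btLog β)) +
            coreEps2 L β (powScale (1 / 3) β) (9 * (L : ℝ) * (5 * (powScale (1 / 2) β * btLog β ^ 2)) + (powScale 1 β)) (min (1 / 40) (powScale (1 / 2) β * btLog β))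
              (powScale (1 / 3) β)) * (1 + ηc β) - 1) ≤ b β) :
    ¬ ∀ a : ℝ, 0 < a → ∀ᶠ β : ℝ in atTop, b β ^ 2 ≤ a * bareLambda ((L : ℝ) ^ 3 * β) :=
  R53S.not_hb_small_of_coreDefect_third (L := L) (δ := fun β => powScale (1 / 3) β) (δu := fun β => powScale (1 / 3) β)
    (R := fun β => min (1 / 40) (powScale (1 / 2) β * btLog β)) (Γ := fun β => powScale 1 β * Fintype.card (Site 3 L)) hc
    (fun β => (powScale_pos _ β).le) (fun β => (powScale_pos _ β).le) (fun β => mul_nonneg (powScale_pos _ β).le (Nat.cast_nonneg _)) hηc hfloor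

/-- Numbers: the record's three window exponents against the box — `s = 1/3 > 1/6` (fine), `p = 1/3 > 1/5` (not a core window), `q = 1/3 ≤ 1/3` (fails). -/
example : (1 : ℝ) / 6 < 1 / 3 ∧ (1 : ℝ) / 5 < 1 / 3 ∧ ¬ ((1 : ℝ) / 3 < 1 / 3) := by norm_num

end Summit.QuantumFields.YangMills.Theorems.TwistedTraceScaling.Negative.R54C

end
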